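import Summits.AnomalousDissipation.AnomalousDissipation.Theorems.SawtoothPulseCascadeK1LocalisedCascadeHMassAuto
import Summits.AnomalousDissipation.AnomalousDissipation.Theorems.SawtoothPulseCascadeK1LocalisedCascadePhaseOneGroupEval
import Summits.AnomalousDissipation.AnomalousDissipation.Theorems.SawtoothPulseCascadeK1LocalisedCascadeVTwistMass

/-!
# K1loc explicit start, phase 1: ONE PIECE OF AN H-FIBRE CERTIFICATE («HPieceBound»)

Helper file of the prover lane on the crux `K1LocalisedCascade` (stmt-AnomalousDissipation-19491), route `SawtoothPulseCascade`
(arbiter A24-6 steps (3)–(5): the per-H-fibre certificates `Σ_{n∈T_p} ω(p,n)‖𝓕b₁(p,n)‖² ≤ V_p` of `…VOJunkFrame`).  For an H-fibre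
`p ≥ 1` of `b₁ = a₁ ∘ Φ_H` and a window `n₁ ≤ |n| ≤ n₂` (`n₁ ≥ 1`) of vertical frequencies:
* `sum_le_sum_cover`: `Σ_{x∈s} f ≤ Σ_{k∈K} Σ_{x∈s, P k x} f` for `f ≥ 0` when the `P k` cover `s`;
* `hfibre_total_le`: the whole fibre, `Σ_{n∈T} ‖𝓕b₁(p,n)‖² ≤ Σ_{1≤|q|≤100} ‖𝓕a₁(p,q)‖² + R_p` for any finite `T` (the H half-step is an
  isometry on each H-fibre), `R_p = Σ'_{q ∉ S} ‖𝓕a₁(p,q)‖²`;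
* **`hpiece_le`**: with the six source groups `Q′ < |q| ≤ Q″` of `(0,4,8,14,22,36,100)`, group `ℓ¹` bounds `v_g`, and mass certificates
  `s_g` for the window (the three-way side condition of `…HMassAuto`), `Σ_{n∈T, n₁≤|n|≤n₂} ‖𝓕b₁(p,n)‖² ≤ 5/2·(Σ_g v_g(s_g + 2⁻²⁷p))² + 10R_p`
  (per-fibre Minkowski `…FibreMinkowski.sqrt_window_sq_norm_hstep_le` on the two mirrored windows, rounding `…sqrt_window_shift_twist_le`).
No definitions; nothing about the crux. [cite: Grafakos2014, Prop. 3.1.2 (5), Prop. 3.2.7 (3)] [problem: turb]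
-/

-- `Summit.<Summit>.<Problem>`: single-conjunct summit, the duplicate namespace segment is deliberate.
set_option linter.dupNamespace false
set_option maxRecDepth 4000

noncomputable section

namespace Summit.AnomalousDissipation.AnomalousDissipation.Theorems.SawtoothPulseCascade.K1Start

open MeasureTheory Filter Topology UnitAddTorus Complex AddCircle
open scoped Real
open Literature.Analysis Literature.Analysis.FunctionSpaces Literature.Analysis.FunctionSpaces.Torus Literature.Analysis.FluidPDE
open Literature.Analysis.FluidPDE.ShearStage
open Literature.Analysis.FluidPDE.SawtoothCascade Literature.Analysis.FluidPDE.SawtoothCascade.CascadeParams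
open Summit.AnomalousDissipation.AnomalousDissipation.Theorems.SawtoothPulseCascade.K1Window

/-! ## §1 Bookkeeping -/

/-- **Covering inequality**: for `f ≥ 0` on `s` and predicates `P k` (`k ∈ K`) covering `s`,
`Σ_{x∈s} f x ≤ Σ_{k∈K} Σ_{x∈s, P k x} f x`. [folklore] -/
theorem sum_le_sum_cover {α β : Type*} (s : Finset α) (K : Finset β) (f : α → ℝ) (P : β → α → Prop)
    [∀ k, DecidablePred (P k)] (hf : ∀ x ∈ s, 0 ≤ f x) (hcov : ∀ x ∈ s, ∃ k ∈ K, P k x) :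
    ∑ x ∈ s, f x ≤ ∑ k ∈ K, ∑ x ∈ s.filter (P k), f x := by
  classical
  have e : ∑ k ∈ K, ∑ x ∈ s.filter (P k), f x = ∑ x ∈ s, ((K.filter (fun k => P k x)).card : ℝ) * f x := by
    simp_rw [Finset.sum_filter]
    rw [Finset.sum_comm]
    refine Finset.sum_congr rfl fun x _ => ?_
    rw [← Finset.sum_filter, Finset.sum_const, nsmul_eq_mul]
  rw [e]
  refine Finset.sum_le_sum fun x hx => ?_
  obtain ⟨k, hk, hPk⟩ := hcov x hx
  have h1 : (1 : ℝ) ≤ (K.filter (fun k => P k x)).card := by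
    have : 1 ≤ (K.filter (fun k => P k x)).card := Finset.card_pos.2 ⟨k, Finset.mem_filter.2 ⟨hk, hPk⟩⟩
    exact_mod_cast this
  nlinarith [hf x hx]

section Cascade

variable (P : CascadeParams) (hγ : P.γ = 8) (hN₀ : P.N₀ = 1) (hρN : P.ρN = 2) (hd : P.d = 2) (hδ₀ : 0 < P.δ₀)
  (hδ₀' : P.δ₀ ≤ (2 : ℝ)⁻¹ ^ 30) (a b : ℕ → UnitAddTorus (Fin 2) → ℝ) (h0 : a 0 = datum)
  (hb : ∀ j, b j = a j ∘ shearMap 0 1 (amp ⟨P.U j, P.U_periodic j, P.contDiff_U (P.δ_pos hδ₀ (by rw [hd]; norm_num) j)⟩ P.γ))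
  (hab : ∀ j, a (j + 1) = b j ∘ shearMap 1 0 (amp ⟨P.U j, P.U_periodic j, P.contDiff_U (P.δ_pos hδ₀ (by rw [hd]; norm_num) j)⟩ P.γ))

include hγ hN₀ hρN hd hδ₀' h0 hb hab

/-! ## §2 The whole fibre: Parseval -/

omit hγ hN₀ hρN hδ₀' in
/-- **The H half-step is an isometry on each H-fibre**: for any finite set `T` of vertical frequencies,
`Σ_{n∈T} ‖𝓕b₁(p,n)‖² ≤ Σ_{1≤|q|≤100} ‖𝓕a₁(p,q)‖² + Σ'_{q∉S} ‖𝓕a₁(p,q)‖²`. [cite: Grafakos2014, Prop. 3.2.7 (3)] -/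
theorem hfibre_total_le (p : ℤ) (T : Finset ℤ) :
    ∑ n ∈ T, ‖mFourierCoeff (fun x => (b 1 x : ℂ)) ![p, n]‖ ^ 2 ≤
      ∑ q ∈ (Finset.Icc (-(100 : ℤ)) 100).filter (fun q => 1 ≤ |q|), ‖mFourierCoeff (fun x => (a 1 x : ℂ)) ![p, q]‖ ^ 2 +
        ∑' q : ℤ, (if q ∈ (Finset.Icc (-(100 : ℤ)) 100).filter (fun q => 1 ≤ |q|) then 0
          else ‖mFourierCoeff (fun x => (a 1 x : ℂ)) ![p, q]‖ ^ 2) := by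
  classical
  have hd' : 0 < P.d := by rw [hd]; norm_num
  set ψ₀ : ShearProfile := amp ⟨P.U 0, P.U_periodic 0, P.contDiff_U (P.δ_pos hδ₀ hd' 0)⟩ P.γ with hψ₀
  set ψ₁ : ShearProfile := amp ⟨P.U 1, P.U_periodic 1, P.contDiff_U (P.δ_pos hδ₀ hd' 1)⟩ P.γ with hψ₁
  have hb0 : b 0 = datum ∘ shearMap 0 1 ψ₀ := by rw [hb 0, h0]
  have ha1 : a 1 = b 0 ∘ shearMap 1 0 ψ₀ := hab 0
  have hb1 : b 1 = a 1 ∘ shearMap 0 1 ψ₁ := hb 1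
  have ha1c : Continuous (a 1) := ha1 ▸ hb0 ▸ (isSmooth_datum_comp_shearMap ψ₀).continuous.comp (continuous_shearMap 1 0 ψ₀)
  have hb1c : Continuous (b 1) := hb1 ▸ ha1c.comp (continuous_shearMap 0 1 ψ₁)
  obtain ⟨c, hc⟩ : ∃ c : (Fin 2 → ℤ) → ℝ, ∀ k, c k = ‖mFourierCoeff (fun x => (b 1 x : ℂ)) k‖ ^ 2 := ⟨_, fun _ => rfl⟩
  obtain ⟨c', hc'⟩ : ∃ c' : (Fin 2 → ℤ) → ℝ, ∀ k, c' k = ‖mFourierCoeff (fun x => (a 1 x : ℂ)) k‖ ^ 2 := ⟨_, fun _ => rfl⟩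
  have hcs : Summable c := (funext hc : c = _) ▸ (hasSum_sq_mFourierCoeff_of_continuous (Complex.continuous_ofReal.comp hb1c)).summable
  have hcs' : Summable c' :=
    (funext hc' : c' = _) ▸ (hasSum_sq_mFourierCoeff_of_continuous (Complex.continuous_ofReal.comp ha1c)).summable
  have hc0 : ∀ k, 0 ≤ c k := fun k => by rw [hc]; exact sq_nonneg _
  have hc0' : ∀ k, 0 ≤ c' k := fun k => by rw [hc']; exact sq_nonneg _
  simp only [← hc, ← hc']
  -- (1) the window on the fibre of `b₁` is at most the full fibre series
  have hinj : Function.Injective (fun n : ℤ => (![p, n] : Fin 2 → ℤ)) := fun x y h => by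
    have := congrFun h 1; simpa using this
  have hline_b : ∑ n ∈ T, c ![p, n] ≤ ∑' n : ℤ, c ![p, n] :=
    (hcs.comp_injective hinj).sum_le_tsum T (fun n _ => hc0 _)
  -- (2) the full fibre of `b₁` equals the full fibre of `a₁` (H-step invariance of horizontal functionals)
  have hfib_eq : ∑' n : ℤ, c ![p, n] = ∑' n : ℤ, c' ![p, n] := by
    have e := tsum_horizontalWeight_hstep ha1c ψ₁ hb1 (w := fun m : ℤ => if m = p then (1 : ℝ) else 0) (C := 1)
      (fun m => by split_ifs <;> simp)
    simp only [← hc, ← hc'] at e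
    have hl : ∀ (g : (Fin 2 → ℤ) → ℝ), Summable g → ∑' k : Fin 2 → ℤ, (if k 0 = p then (1 : ℝ) else 0) * g k = ∑' n : ℤ, g ![p, n] := by
      intro g hg
      have h1 := tsum_line_compl_eq_tsum_hslab g p ∅
      simp only [Finset.notMem_empty, if_false, not_false_eq_true, and_true] at h1
      rw [h1]
      refine tsum_congr fun k => ?_
      split_ifs <;> simp
    rw [← hl c hcs, ← hl c' hcs', e]
  -- (3) split the fibre of `a₁` at the source set
  have hsplit : ∑' n : ℤ, c' ![p, n] = ∑ q ∈ (Finset.Icc (-(100 : ℤ)) 100).filter (fun q => 1 ≤ |q|), c' ![p, q] +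
      ∑' q : ℤ, (if q ∈ (Finset.Icc (-(100 : ℤ)) 100).filter (fun q => 1 ≤ |q|) then 0 else c' ![p, q]) := by
    have hs := hcs'.comp_injective hinj
    set S := (Finset.Icc (-(100 : ℤ)) 100).filter (fun q => 1 ≤ |q|) with hS
    have h1 : Summable fun q : ℤ => if q ∈ S then c' ![p, q] else 0 := summable_of_ne_finset_zero (s := S) fun q hq => if_neg hq
    have h2 : Summable fun q : ℤ => if q ∈ S then 0 else c' ![p, q] := by
      refine (hs.sub h1).congr fun q => ?_
      by_cases hq : q ∈ S <;> simp [hq]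
    have e : ∀ q : ℤ, c' ![p, q] = (if q ∈ S then c' ![p, q] else 0) + (if q ∈ S then 0 else c' ![p, q]) := fun q => by
      by_cases hq : q ∈ S <;> simp [hq]
    rw [tsum_congr e, h1.tsum_add h2, tsum_eq_sum (s := S) fun q hq => if_neg hq]
    all_goals exact congrArg₂ (· + ·) (Finset.sum_congr rfl fun q hq => if_pos hq) rfl
  rw [← hsplit, ← hfib_eq]
  exact hline_b

/-! ## §3 One window piece: Minkowski over the sources, grouped -/

/-- **ONE PIECE OF AN H-FIBRE CERTIFICATE**: `1 ≤ p`, a window `1 ≤ n₁`, `n₂`, group `ℓ¹` bounds `Σ_{Q′_g<|q|≤Q″_g} ‖𝓕a₁(p,q)‖ ≤ v_g`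
for the six groups `(0,4],(4,8],(8,14],(14,22],(22,36],(36,100]`, and mass data `x_g, y_g, s_g` satisfying the three-way condition of
`…HMassAuto` for the window `[n₁,n₂]` and `Q = Q″_g`: then for every finite `T`,
`Σ_{n∈T, n₁≤|n|≤n₂} ‖𝓕b₁(p,n)‖² ≤ 5/2·(Σ_g v_g(s_g + 2⁻²⁷p))² + 10·R_p`. [cite: Grafakos2014, Prop. 3.1.2 (5), Prop. 3.2.7 (3)] -/
theorem hpiece_le (p : ℤ) (hp : 1 ≤ p) (n₁ n₂ : ℤ) (hn₁ : 1 ≤ n₁) (v x y s : Fin 6 → ℝ)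
    (hv : ∀ g : Fin 6, ∑ q ∈ ((Finset.Icc (-(100 : ℤ)) 100).filter (fun q => 1 ≤ |q|)).filter
        (fun q => ((![0, 4, 8, 14, 22, 36] : Fin 6 → ℕ) g : ℤ) < |q| ∧ |q| ≤ ((![4, 8, 14, 22, 36, 100] : Fin 6 → ℕ) g : ℤ)),
        ‖mFourierCoeff (fun x => (a 1 x : ℂ)) ![p, q]‖ ≤ v g)
    (hmass : ∀ g : Fin 6, (1 ≤ s g) ∨
      (0 ≤ x g ∧ 0 ≤ y g ∧ (n₁ - ((![4, 8, 14, 22, 36, 100] : Fin 6 → ℕ) g) - 2) / 4 ≤ (n₂ + ((![4, 8, 14, 22, 36, 100] : Fin 6 → ℕ) g) + 5) / 4 ∧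
        4 * ((n₂ + ((![4, 8, 14, 22, 36, 100] : Fin 6 → ℕ) g) + 5) / 4) < 8 * p ∧ 0 ≤ n₁ - ((![4, 8, 14, 22, 36, 100] : Fin 6 → ℕ) g) - 2 ∧
        1 / (8 * (p : ℝ) - 4 * (((n₂ + ((![4, 8, 14, 22, 36, 100] : Fin 6 → ℕ) g) + 5) / 4 : ℤ) : ℝ)) -
          1 / (8 * (p : ℝ) - 4 * (((n₁ - ((![4, 8, 14, 22, 36, 100] : Fin 6 → ℕ) g) - 2) / 4 : ℤ) : ℝ)) ≤ x g ^ 2 ∧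
        1 / (8 * (p : ℝ) + 4 * (((n₁ - ((![4, 8, 14, 22, 36, 100] : Fin 6 → ℕ) g) - 2) / 4 : ℤ) : ℝ)) -
          1 / (8 * (p : ℝ) + 4 * (((n₂ + ((![4, 8, 14, 22, 36, 100] : Fin 6 → ℕ) g) + 5) / 4 : ℤ) : ℝ)) ≤ y g ^ 2 ∧
        0.3184 * (x g + y g) ≤ s g) ∨
      (0 ≤ s g ∧ (n₁ - ((![4, 8, 14, 22, 36, 100] : Fin 6 → ℕ) g) - 2) / 4 ≤ (n₂ + ((![4, 8, 14, 22, 36, 100] : Fin 6 → ℕ) g) + 5) / 4 ∧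
        8 * p < 4 * ((n₁ - ((![4, 8, 14, 22, 36, 100] : Fin 6 → ℕ) g) - 2) / 4) ∧
        0.101322 * (1 / (4 * (((n₁ - ((![4, 8, 14, 22, 36, 100] : Fin 6 → ℕ) g) - 2) / 4 : ℤ) : ℝ) - 8 * p) -
          1 / (4 * (((n₂ + ((![4, 8, 14, 22, 36, 100] : Fin 6 → ℕ) g) + 5) / 4 : ℤ) : ℝ) - 8 * p)) ≤ s g ^ 2))
    (T : Finset ℤ) :
    ∑ n ∈ T.filter (fun n => n₁ ≤ |n| ∧ |n| ≤ n₂), ‖mFourierCoeff (fun x => (b 1 x : ℂ)) ![p, n]‖ ^ 2 ≤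
      5 / 2 * (∑ g : Fin 6, v g * (s g + (2 : ℝ)⁻¹ ^ 27 * p)) ^ 2 +
        10 * ∑' q : ℤ, (if q ∈ (Finset.Icc (-(100 : ℤ)) 100).filter (fun q => 1 ≤ |q|) then 0
          else ‖mFourierCoeff (fun x => (a 1 x : ℂ)) ![p, q]‖ ^ 2) := by
  classical
  have hπ : 0 < π := Real.pi_pos
  have hd' : 0 < P.d := by rw [hd]; norm_num
  set ψ₀ : ShearProfile := amp ⟨P.U 0, P.U_periodic 0, P.contDiff_U (P.δ_pos hδ₀ hd' 0)⟩ P.γ with hψ₀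
  set ψ₁ : ShearProfile := amp ⟨P.U 1, P.U_periodic 1, P.contDiff_U (P.δ_pos hδ₀ hd' 1)⟩ P.γ with hψ₁
  have hb0 : b 0 = datum ∘ shearMap 0 1 ψ₀ := by rw [hb 0, h0]
  have ha1 : a 1 = b 0 ∘ shearMap 1 0 ψ₀ := hab 0
  have hb1 : b 1 = a 1 ∘ shearMap 0 1 ψ₁ := hb 1
  have ha1s : IsSmooth (a 1) := ha1 ▸ hb0 ▸ (isSmooth_datum_comp_shearMap ψ₀).comp_shearMap 1 0 ψ₀
  have hθc : Continuous (fun x => (a 1 x : ℂ)) := Complex.continuous_ofReal.comp ha1s.continuous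
  have hθsum : Summable fun k => ‖mFourierCoeff (fun x => (a 1 x : ℂ)) k‖ := summable_norm_mFourierCoeff_ofReal_of_isSmooth ha1s
  have hb1θ : (fun x => (b 1 x : ℂ)) = (fun x => (a 1 x : ℂ)) ∘ shearMap 0 1 ψ₁ := by rw [hb1]; rfl
  set S : Finset ℤ := (Finset.Icc (-(100 : ℤ)) 100).filter (fun q => 1 ≤ |q|) with hS
  set QL : Fin 6 → ℕ := ![0, 4, 8, 14, 22, 36] with hQL
  set QH : Fin 6 → ℕ := ![4, 8, 14, 22, 36, 100] with hQH
  set r : ℝ := (2 : ℝ)⁻¹ ^ 27 * p with hr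
  set R : ℝ := ∑' q : ℤ, (if q ∈ S then 0 else ‖mFourierCoeff (fun x => (a 1 x : ℂ)) ![p, q]‖ ^ 2) with hRdef
  have hR0 : 0 ≤ R := tsum_nonneg fun q => by split_ifs <;> positivity
  -- mass and table facts
  have hs0 : ∀ g, 0 ≤ s g := by
    intro g; rcases hmass g with h | ⟨hx, hy, -, -, -, -, -, h⟩ | ⟨h, -⟩
    · linarith
    · nlinarith
    · exact h
  have hv0 : ∀ g, 0 ≤ v g := fun g => le_trans (Finset.sum_nonneg fun _ _ => norm_nonneg _) (hv g)
  have hp0R : (0 : ℝ) ≤ p := by exact_mod_cast (by omega : (0 : ℤ) ≤ p)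
  have hr0 : 0 ≤ r := by rw [hr]; positivity
  -- the exact chirp of the fibre and the rounding
  obtain ⟨hg₀c, hg₀⟩ := continuous_exactChirp_lift 2 (8 * p)
  have hg₀' : ∀ t : ℝ, (periodic_exactChirpFun 2 (8 * p)).lift (t : UnitAddCircle) =
      cexp (-(2 * π * I * ((((8 * p : ℤ) : ℝ) * (tri (2 * π * (2 : ℕ) * t) / (2 * π * (2 : ℕ))) : ℝ) : ℂ))) := by
    intro t; rw [hg₀ t]; push_cast; ring_nf
  have hnear : ∀ t : ℝ, |p * ψ₁ t - ((8 * p : ℤ) : ℝ) * (tri (2 * π * (2 : ℕ) * t) / (2 * π * (2 : ℕ)))| ≤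
      |(p : ℝ)| * ((2 * Real.exp (1 / 2) - 1) * P.δ₀ / π) := fun t => by
    rw [hψ₁]; exact phaseOne_profile_near P hγ hN₀ hρN hd hδ₀ p t
  have hround : 2 * π * (|(p : ℝ)| * ((2 * Real.exp (1 / 2) - 1) * P.δ₀ / π)) ≤ r := by
    rw [hr, show (p : ℝ) = |(p : ℝ)| from (abs_of_pos (by exact_mod_cast (by omega : (0:ℤ) < p))).symm]
    rw [abs_abs]; exact phaseOne_rounding_le hδ₀.le hδ₀' p
  -- the Minkowski bound on one window `W`
  have hwin : ∀ W : Finset ℤ, (∀ g : Fin 6, ∀ q : ℤ, |q| ≤ QH g →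
      ∑ n ∈ W, ‖fourierCoeff ((periodic_exactChirpFun 2 (8 * p)).lift) (n - q)‖ ^ 2 ≤ s g ^ 2) →
      ∑ n ∈ W, ‖mFourierCoeff (fun x => (b 1 x : ℂ)) ![p, n]‖ ^ 2 ≤ 5 / 4 * (∑ g : Fin 6, v g * (s g + r)) ^ 2 + 5 * R := by
    intro W hW
    have hM := sqrt_window_sq_norm_hstep_le hθc hθsum ψ₁ p S W
    rw [← hb1θ] at hM
    -- per source: `√μ_q ≤ s_g + r`
    have hμ : ∀ g : Fin 6, ∀ q ∈ S.filter (fun q => (QL g : ℤ) < |q| ∧ |q| ≤ (QH g : ℤ)),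
        Real.sqrt (∑ m ∈ W, ‖fourierCoeff (twist ψ₁ p) (m - q)‖ ^ 2) ≤ s g + r := by
      intro g q hq
      have hqQ : |q| ≤ QH g := (Finset.mem_filter.1 hq).2.2
      have h1 := sqrt_window_shift_twist_le ψ₁ p q hg₀' hg₀c hnear W
      have h2 : Real.sqrt (∑ m ∈ W, ‖fourierCoeff ((periodic_exactChirpFun 2 (8 * p)).lift) (m - q)‖ ^ 2) ≤ s g := by
        rw [← Real.sqrt_sq (hs0 g)]; exact Real.sqrt_le_sqrt (hW g q hqQ)
      linarith
    -- group the sources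
    have hgrp : ∑ q ∈ S, ‖mFourierCoeff (fun x => (a 1 x : ℂ)) ![p, q]‖ *
        Real.sqrt (∑ m ∈ W, ‖fourierCoeff (twist ψ₁ p) (m - q)‖ ^ 2) ≤ ∑ g : Fin 6, v g * (s g + r) := by
      refine (sum_le_sum_cover S (Finset.univ : Finset (Fin 6)) _ (fun g q => (QL g : ℤ) < |q| ∧ |q| ≤ (QH g : ℤ))
        (fun q _ => mul_nonneg (norm_nonneg _) (Real.sqrt_nonneg _)) (fun q hq => ?_)).trans ?_
      · -- every source lies in a group
        have h := (Finset.mem_filter.1 hq)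
        rw [Finset.mem_Icc] at h
        have habs := abs_le.2 ⟨h.1.1, h.1.2⟩
        have h1 := h.2
        have hq1 := abs_choice q; have hq2 := abs_nonneg q
        simp only [hQL, hQH, Finset.mem_univ, true_and]
        by_cases h4 : |q| ≤ 4
        · exact ⟨0, by simp only [Matrix.cons_val]; omega⟩
        by_cases h8 : |q| ≤ 8
        · exact ⟨1, by simp only [Matrix.cons_val]; omega⟩
        by_cases h14 : |q| ≤ 14
        · exact ⟨2, by simp only [Matrix.cons_val]; omega⟩
        by_cases h22 : |q| ≤ 22
        · exact ⟨3, by simp only [Matrix.cons_val]; omega⟩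
        by_cases h36 : |q| ≤ 36
        · exact ⟨4, by simp only [Matrix.cons_val]; omega⟩
        · exact ⟨5, by simp only [Matrix.cons_val]; omega⟩
      · refine Finset.sum_le_sum fun g _ => ?_
        calc ∑ q ∈ S.filter (fun q => (QL g : ℤ) < |q| ∧ |q| ≤ (QH g : ℤ)), ‖mFourierCoeff (fun x => (a 1 x : ℂ)) ![p, q]‖ *
              Real.sqrt (∑ m ∈ W, ‖fourierCoeff (twist ψ₁ p) (m - q)‖ ^ 2)
            ≤ ∑ q ∈ S.filter (fun q => (QL g : ℤ) < |q| ∧ |q| ≤ (QH g : ℤ)), ‖mFourierCoeff (fun x => (a 1 x : ℂ)) ![p, q]‖ * (s g + r) :=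
              Finset.sum_le_sum fun q hq => mul_le_mul_of_nonneg_left (hμ g q hq) (norm_nonneg _)
          _ = (∑ q ∈ S.filter (fun q => (QL g : ℤ) < |q| ∧ |q| ≤ (QH g : ℤ)), ‖mFourierCoeff (fun x => (a 1 x : ℂ)) ![p, q]‖) * (s g + r) := by
              rw [Finset.sum_mul]
          _ ≤ v g * (s g + r) := mul_le_mul_of_nonneg_right (hv g) (add_nonneg (hs0 g) hr0)
    have hM0 : 0 ≤ ∑ g : Fin 6, v g * (s g + r) := Finset.sum_nonneg fun g _ => mul_nonneg (hv0 g) (add_nonneg (hs0 g) hr0)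
    have hX0 : 0 ≤ ∑ n ∈ W, ‖mFourierCoeff (fun x => (b 1 x : ℂ)) ![p, n]‖ ^ 2 := Finset.sum_nonneg fun _ _ => sq_nonneg _
    have hsq : Real.sqrt (∑ n ∈ W, ‖mFourierCoeff (fun x => (b 1 x : ℂ)) ![p, n]‖ ^ 2) ≤
        (∑ g : Fin 6, v g * (s g + r)) + Real.sqrt R := hM.trans (add_le_add hgrp le_rfl)
    have h5 := add_sq_le_five_quarters (∑ g : Fin 6, v g * (s g + r)) (Real.sqrt R)
    rw [Real.sq_sqrt hR0] at h5
    calc ∑ n ∈ W, ‖mFourierCoeff (fun x => (b 1 x : ℂ)) ![p, n]‖ ^ 2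
        = Real.sqrt (∑ n ∈ W, ‖mFourierCoeff (fun x => (b 1 x : ℂ)) ![p, n]‖ ^ 2) ^ 2 := (Real.sq_sqrt hX0).symm
      _ ≤ ((∑ g : Fin 6, v g * (s g + r)) + Real.sqrt R) ^ 2 := pow_le_pow_left₀ (Real.sqrt_nonneg _) hsq 2
      _ ≤ _ := h5
  -- the two mirrored windows
  have hpos := hwin (Finset.Icc n₁ n₂) (fun g q hq => hmassAuto_pos hp (hmass g) q hq)
  have hneg := hwin (Finset.Icc (-n₂) (-n₁)) (fun g q hq => hmassAuto_neg hp (hmass g) q hq)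
  have hsub : T.filter (fun n => n₁ ≤ |n| ∧ |n| ≤ n₂) ⊆ Finset.Icc n₁ n₂ ∪ Finset.Icc (-n₂) (-n₁) := by
    intro n hn
    rw [Finset.mem_filter] at hn
    rw [Finset.mem_union, Finset.mem_Icc, Finset.mem_Icc]
    have := abs_choice n; omega
  calc ∑ n ∈ T.filter (fun n => n₁ ≤ |n| ∧ |n| ≤ n₂), ‖mFourierCoeff (fun x => (b 1 x : ℂ)) ![p, n]‖ ^ 2
      ≤ ∑ n ∈ Finset.Icc n₁ n₂ ∪ Finset.Icc (-n₂) (-n₁), ‖mFourierCoeff (fun x => (b 1 x : ℂ)) ![p, n]‖ ^ 2 :=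
        Finset.sum_le_sum_of_subset_of_nonneg hsub fun _ _ _ => sq_nonneg _
    _ ≤ _ := by
          rw [← Finset.sum_union_inter]
          exact le_add_of_nonneg_right (Finset.sum_nonneg fun n _ => sq_nonneg (‖mFourierCoeff (fun x => (b 1 x : ℂ)) ![p, n]‖))
    _ ≤ _ := add_le_add hpos hneg
    _ = 5 / 2 * (∑ g : Fin 6, v g * (s g + r)) ^ 2 + 10 * R := by ring

end Cascade

end Summit.AnomalousDissipation.AnomalousDissipation.Theorems.SawtoothPulseCascade.K1Start
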